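import Literature.NumberTheory.Sieve.IwaniecAlmostPrimesMertens
import HarnessLib

/-!
# Iwaniec (1978): Mertens' first theorem for `ρ` — asymptotic forms of `RhoMertensStrong`

`Literature.NumberTheory.Sieve.IwaniecAlmostPrimesMertens` states the named fact
`RhoMertensStrong : ∃ C, ∀ t ≥ 1, |∑_{p ≤ t} ρ(p) log p / p − log t| ≤ C`
(`ρ(p) = 1 + χ₄(p)` = the number of roots of `ν² + 1 ≡ 0 (mod p)`,
`rhoLogSum t = ∑_{p ≤ t} ρ(p) log p / p`) and PROVES it there, in full, as
`theorem RhoMertensStrong_holds : RhoMertensStrong` (named `rhoMertensStrong_holds` before the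
2026-08-15 dedup), from Mertens' theorem for the non-principal character mod `4` —
T. M. Apostol, *Introduction to Analytic Number Theory* (Springer 1976), §7.3 eq. (4) via
Lemmas 7.5–7.6 and `L(1, χ₄) ≠ 0` (Theorem 6.20), the case `k = 4` of his Theorem 7.3 — together
with the tree's two-sided Mertens I
`Literature.NumberTheory.LFunctions.MertensBound.sum_log_div_prime_bounds`.  That is the
"assumption on the sifting density of `ρ`" of H. Iwaniec, *Almost-primes represented by quadratic
polynomials*, Invent. Math. **47** (1978) 171–188, §5 p. 185.

This module does NOT restate that proof (an earlier revision held only a cross-file alias of it,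
removed as a duplicate, dedup-00295).  It records the two standard asymptotic readings of the fact
in Mathlib's `Asymptotics` language, each taking the fact as an explicit hypothesis
`(h : RhoMertensStrong)` (dot notation: `h.isBigO_sub_log`, `h.isEquivalent_log`):

* `RhoMertensStrong.isBigO_sub_log` — `R(t) − log t = O(1)` as `t → ∞`;
* `RhoMertensStrong.isEquivalent_log` — `R(t) ~ log t` as `t → ∞` (since `1 = o(log t)`).

## References

* T. M. Apostol, *Introduction to Analytic Number Theory*, Springer GTM, 1976: Theorem 7.3,
  §7.3 eq. (4), Lemmas 7.4–7.6, Theorem 6.20 (`Apostol1976`).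
* H. Iwaniec, Invent. Math. 47 (1978) 171–188, §5 p. 185 (`IwaniecInventiones1978`).
-/

open Filter Asymptotics

noncomputable section

namespace Literature.NumberTheory.Sieve.Iwaniec1978

/-- **Mertens I for `ρ`, `O(1)` form**: under `RhoMertensStrong`,
`∑_{p ≤ t} ρ(p) log p / p − log t = O(1)` as `t → ∞` (Apostol, Theorem 7.3 with `k = 4`, read in
Landau notation). [cite: Apostol1976, Theorem 7.3] -/
theorem RhoMertensStrong.isBigO_sub_log (h : RhoMertensStrong) :
    (fun t : ℝ => rhoLogSum t - Real.log t) =O[atTop] fun _ : ℝ => (1 : ℝ) := by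
  obtain ⟨C, hC⟩ := h
  refine IsBigO.of_bound C ?_
  filter_upwards [eventually_ge_atTop (1 : ℝ)] with t ht
  simpa only [Real.norm_eq_abs, abs_one, mul_one] using hC t ht

/-- **Mertens I for `ρ`, equivalent form**: under `RhoMertensStrong`,
`∑_{p ≤ t} ρ(p) log p / p ~ log t` as `t → ∞` (the `O(1)` error is `o(log t)`). [folklore] -/
theorem RhoMertensStrong.isEquivalent_log (h : RhoMertensStrong) :
    rhoLogSum ~[atTop] Real.log :=
  h.isBigO_sub_log.trans_isLittleO Real.isLittleO_const_log_atTop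

end Literature.NumberTheory.Sieve.Iwaniec1978

end
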